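import Literature.Computability.Cryptography.ChenQuantumLWEStepEightReversal

/-!
# The Fourier de-chirp: the offset reader of a known direction as a three-layer circuit (T22)

REPRODUCTION / ANALYSIS OF A CLAIMED RESULT UNDER ADJUDICATION (withdrawn): Yilei Chen, *Quantum
Algorithms for Lattice Problems*, IACR ePrint 2024/555, version of 2024-04-18 [ChenQuantumLattice2024]
(the version carrying the author's note that Step 9 contains a bug), Step 9 (§3.5.9, pp. 34–38) acting
on the line ket `|φ_{b,v′}⟩ = |φ8.b⟩ = Σ_{j ∈ ℤ_P} ψ_P(−j²) |2D²j·b + v′ mod N⟩` (p. 35), `P = p₁Q`,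
`N = D²P`, with the QFT of Lemma 2.12 (p. 12) and the phase kickback of Lemma 2.13 (p. 13).  Bundle
`papers/QuantumAdvantage/lwe-quantum-autopsy/`, Part 2 (`REPAIR-CENSUS.md` §27.2 — the identity
`V_b = g_P · F⁻¹ · diag_y ψ_P(⟨b,y⟩²) · F`, stated and numerically checked there BY HAND — and §30,
theorem **T22**, census row G7 / item G7a), sequel of `ChenQuantumLWEChirpFourier.lean` (T3:
`qft_phi8bKet`, the flat Fourier spectrum) and `ChenQuantumLWEStepEightReversal.lean` (`qftInv`,
`qftInv_qft`), companion of `ChenQuantumLWEChirpBasis.lean` (T18: the chirp basis of a direction is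
orthogonal and its projective measurement reads the offset with certainty — an EXISTENCE statement about
a measurement; here is the CIRCUIT).  HONEST FRAMING: kernel-checked IDENTITIES about states occurring
in a WITHDRAWN algorithm — they make precise what the holder of the secret direction can do with the
Step-9 register and why Chen's own Step 9 could not; NOT summit progress, no cryptanalytic claim in
either direction, no new algorithm (the circuit needs the secret `b`).

## What is proved

**1. Completing the square** (`chirpGauss`, `norm_sq_chirpGauss`, `sum_stdAddChar_chirp_linear`,
`qft_phi8bKet_eq_chirpGauss_mul`).  With the chirp Gauss sum `G_P := Σ_{j ∈ ℤ_P} ψ_P(−j²)`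
(`|G_P|² = P` for odd `P`, T3's `norm_sq_sum_stdAddChar_quadratic`), re-indexing `j ↦ j + L` gives
`Σ_j ψ_P(−j² − 2Lj) = ψ_P(L²) · G_P` for every `L ∈ ℤ_P` (no parity hypothesis), hence the Fourier
transform of the line ket FACTORISES:
`QFT|φ_{b,v′}⟩(u) = G_P · ψ_P(⟨b, u mod P⟩²) · ψ_N(−⟨v′, u⟩)` — a plane wave carrying the offset,
times a quadratic phase along the secret direction (`lineFun b u = ⟨b, u mod P⟩`), times a constant.

**2. The de-chirp circuit** (`dechirpKick`, `e_dechirpKick`, `kick_dechirp_qft_phi8bKet`,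
`qftInv_kick_dechirp_qft_phi8bKet`).  The phase kickback (Lemma 2.13) by `−(⟨b, u mod P⟩²)/P`
turns — one inner product with the KNOWN `b` reduced mod `P`, one modular squaring — removes the
quadratic phase: `kick ∘ QFT |φ_{b,v′}⟩ = QFT (G_P • |v′ mod N⟩)`, and therefore
**`QFT⁻¹ ∘ kick_b ∘ QFT |φ_{b,v′}⟩ = (G_P · N^{n+1}) • |v′ mod N⟩`** (unnormalised transforms,
`qftInv_qft`): the register collapses onto the computational-basis point `v′ mod N`.

**3. Born law of the circuit** (`weight_dechirpCircuit`, `weight_dechirpCircuit_of_ne`,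
`sum_weight_dechirpCircuit`, `weight_dechirpCircuit_offsetRes`).  Measuring the computational basis
after the circuit returns `v′ mod N` WITH CERTAINTY (all Born weight, `P · N^{2(n+1)} > 0` for odd
`P`, sits on that one outcome) — all `n + 1` residue coordinates of the offset, in particular the datum
`v′₀ mod Q` and the Step-8 value that Step 9† needs (census O1).  This is the circuit form of T18's
offset reader and the coherent twin of Chen's Step 9: Chen removes the chirp `ψ_P(−j²)` in the POSITION
domain by kicking back `ψ_P(j²)` from a register value `j` that the register does not hold; in the
FOURIER domain the chirp is `ψ_P(⟨b,y⟩²)` and removing it takes exactly the direction `b mod P`.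

**4. A wrong direction leaves a chirp** (`kick_dechirp_qft_phi8bKet_dir`).  De-chirping with any
`b′` leaves `G_P · ψ_P(⟨b,y⟩² − ⟨b′,y⟩²) · ψ_N(−⟨v′,y⟩)`: a plane wave only when the residual
quadratic phase is constant (what `b′` must share with `b` is settled by T18 (4): the class mod `Q`
for the datum).

## What is NOT here

Gate counts (the three layers are QFT, one diagonal phase, QFT⁻¹ — `poly(n, log N)` given `b`, by
hand, census §27.2); anything about OBTAINING `b` from the instance (that is LWE itself, census §27.5
(iii)); any cryptanalytic claim.
-/

namespace Literature.Computability.Cryptography.Chen2024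

open scoped BigOperators

/-! ### 1. The chirp Gauss constant and the completed square -/

section GaussConstant

variable (p₁ Q : ℕ+)

/-- The chirp Gauss sum `G_P := Σ_{j ∈ ℤ_P} ψ_P(−j²)` (the `u`-independent factor of `QFT|φ8.b⟩`).
[cite: ChenQuantumLattice2024, §3.5.9 p. 35; Korobov1992, Ch. I §3] -/
noncomputable def chirpGauss : ℂ := ∑ j : ZP p₁ Q, (ZMod.stdAddChar (-(j ^ 2) : ZP p₁ Q) : ℂ)

/-- `|G_P|² = P` for odd `P` (T3's Gauss-sum evaluation with linear coefficient `0`).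
[cite: Korobov1992, Ch. I §3 Thm 3] -/
theorem norm_sq_chirpGauss (hP : Odd ((p₁ * Q : ℕ+) : ℕ)) :
    ‖chirpGauss p₁ Q‖ ^ 2 = ((p₁ * Q : ℕ+) : ℕ) := by
  have h := Literature.NumberTheory.GaussSums.norm_sq_sum_stdAddChar_quadratic ((p₁ * Q : ℕ+) : ℕ) hP
    (-1) 0 isUnit_one.neg
  simpa only [chirpGauss, neg_mul, one_mul, zero_mul, add_zero] using h

/-- `G_P ≠ 0` for odd `P`. [cite: Korobov1992, Ch. I §3 Thm 3] -/
theorem chirpGauss_ne_zero (hP : Odd ((p₁ * Q : ℕ+) : ℕ)) : chirpGauss p₁ Q ≠ 0 := by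
  intro h
  have h2 := norm_sq_chirpGauss p₁ Q hP
  rw [h, norm_zero, zero_pow two_ne_zero] at h2
  exact (NeZero.ne ((p₁ * Q : ℕ+) : ℕ)) (by exact_mod_cast h2.symm)

/-- **Completing the square:** `Σ_{j ∈ ℤ_P} ψ_P(−j² − 2Lj) = ψ_P(L²) · G_P` (re-index `j ↦ j + L`; no
parity hypothesis). [folklore] -/
theorem sum_stdAddChar_chirp_linear (L : ZP p₁ Q) :
    ∑ j : ZP p₁ Q, (ZMod.stdAddChar ((-1) * j ^ 2 + (-(2 * L)) * j) : ℂ)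
      = ZMod.stdAddChar (L ^ 2) * chirpGauss p₁ Q := by
  rw [chirpGauss, Finset.mul_sum]
  refine Fintype.sum_equiv (Equiv.addRight L) _ _ fun j => ?_
  rw [Equiv.coe_addRight, ← AddChar.map_add_eq_mul]
  congr 1
  ring

end GaussConstant

/-! ### 2. The factorised Fourier transform and the de-chirp circuit -/

section Dechirp

variable (n : ℕ) (D p₁ Q : ℕ+) (b v' : Fin (n + 1) → ℤ)

/-- **`QFT|φ_{b,v′}⟩` factorised:** `G_P · ψ_P(⟨b, u mod P⟩²) · ψ_N(−⟨v′,u⟩)` — constant × quadratic phase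
along the secret direction × plane wave of the offset. [cite: ChenQuantumLattice2024, §3.5.9 p. 35] -/
theorem qft_phi8bKet_eq_chirpGauss_mul (u : Fin (n + 1) → ZN D p₁ Q) :
    qft (phi8bKet n D p₁ Q b v') u
      = chirpGauss p₁ Q * ZMod.stdAddChar (lineFun n D p₁ Q b u ^ 2)
          * ZMod.stdAddChar (-offsetFun n D p₁ Q v' u) := by
  rw [qft_phi8bKet, sum_stdAddChar_chirp_linear]
  ring

/-- The residue offset `v′ mod N` as a register value (the point the circuit collapses onto). [folklore] -/
def offsetRes : Fin (n + 1) → ZN D p₁ Q := fun i => ((v' i : ℤ) : ZN D p₁ Q)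

/-- `⟨v′, u⟩ = Σ_i (v′ mod N)_i · u_i`. [folklore] -/
theorem offsetFun_eq_sum_offsetRes (u : Fin (n + 1) → ZN D p₁ Q) :
    offsetFun n D p₁ Q v' u = ∑ i, offsetRes n D p₁ Q v' i * u i := rfl

/-- The DE-CHIRP kick of direction `b`, in turns (Lemma 2.13): `u ↦ −(⟨b, u mod P⟩² mod P)/P` — computable
from `u` and the KNOWN `b`. [cite: ChenQuantumLattice2024, Lemma 2.13 p. 13, §3.5.9 p. 35] -/
noncomputable def dechirpKick (u : Fin (n + 1) → ZN D p₁ Q) : ℚ :=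
  -((((lineFun n D p₁ Q b u ^ 2).val : ℕ) : ℚ) / ((p₁ * Q : ℕ+) : ℕ))

/-- The de-chirp kick is the phase `ψ_P(−⟨b, u mod P⟩²)`. [folklore] -/
theorem e_dechirpKick (u : Fin (n + 1) → ZN D p₁ Q) :
    e (dechirpKick n D p₁ Q b u) = ZMod.stdAddChar (-(lineFun n D p₁ Q b u ^ 2)) := by
  rw [dechirpKick, e_neg_natCast_div, ZMod.natCast_zmod_val]

/-- `QFT` of a scaled basis ket is a plane wave: `QFT(c|y⟩)(u) = c · ψ_m(−⟨y,u⟩)`.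
[cite: ChenQuantumLattice2024, Lemma 2.12 p. 12] -/
theorem qft_smul_basisKet {k m : ℕ} [NeZero m] (c : ℂ) (y u : Fin k → ZMod m) :
    qft (c • basisKet y) u = c * ZMod.stdAddChar (-(∑ i, y i * u i)) := by
  classical
  rw [qft_apply_eq_sum_stdAddChar]
  simp only [Pi.smul_apply, basisKet, smul_eq_mul, mul_ite, mul_one, mul_zero, ite_mul, zero_mul,
    Finset.sum_ite_eq', Finset.mem_univ, if_true]

/-- **De-chirp, step 1:** `kick_b (QFT|φ_{b,v′}⟩) = QFT (G_P • |v′ mod N⟩)` — the quadratic phase is gone,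
a scaled plane wave remains. [cite: ChenQuantumLattice2024, Lemma 2.13 p. 13, §3.5.9 p. 35] -/
theorem kick_dechirp_qft_phi8bKet :
    kick (dechirpKick n D p₁ Q b) (qft (phi8bKet n D p₁ Q b v'))
      = qft (chirpGauss p₁ Q • basisKet (offsetRes n D p₁ Q v')) := by
  funext u
  show qft (phi8bKet n D p₁ Q b v') u * e (dechirpKick n D p₁ Q b u) = _
  rw [qft_phi8bKet_eq_chirpGauss_mul, e_dechirpKick, qft_smul_basisKet, ← offsetFun_eq_sum_offsetRes]
  have h1 : (ZMod.stdAddChar (lineFun n D p₁ Q b u ^ 2) : ℂ)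
      * ZMod.stdAddChar (-(lineFun n D p₁ Q b u ^ 2)) = 1 := by
    rw [← AddChar.map_add_eq_mul, add_neg_cancel, AddChar.map_zero_eq_one]
  calc chirpGauss p₁ Q * ZMod.stdAddChar (lineFun n D p₁ Q b u ^ 2)
          * ZMod.stdAddChar (-offsetFun n D p₁ Q v' u) * ZMod.stdAddChar (-(lineFun n D p₁ Q b u ^ 2))
        = chirpGauss p₁ Q * ZMod.stdAddChar (-offsetFun n D p₁ Q v' u)
          * ((ZMod.stdAddChar (lineFun n D p₁ Q b u ^ 2) : ℂ)
              * ZMod.stdAddChar (-(lineFun n D p₁ Q b u ^ 2))) := by ring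
    _ = chirpGauss p₁ Q * ZMod.stdAddChar (-offsetFun n D p₁ Q v' u) := by rw [h1, mul_one]

/-- **T22 (the de-chirp circuit).** `QFT⁻¹ (kick_b (QFT |φ_{b,v′}⟩)) = (G_P · N^{n+1}) • |v′ mod N⟩`: three
layers — QFT, the diagonal phase `ψ_P(−⟨b,y⟩²)` of the KNOWN direction, QFT⁻¹ — collapse the Step-9
register onto the point `v′ mod N` (census §27.2's `V_b = g_P F⁻¹ diag F`, unnormalised).
[cite: ChenQuantumLattice2024, Lemma 2.12 p. 12, Lemma 2.13 p. 13, §3.5.9 p. 35] -/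
theorem qftInv_kick_dechirp_qft_phi8bKet :
    qftInv (kick (dechirpKick n D p₁ Q b) (qft (phi8bKet n D p₁ Q b v')))
      = (chirpGauss p₁ Q * ((((D * D * (p₁ * Q) : ℕ+) : ℕ) : ℂ)) ^ (n + 1))
          • basisKet (offsetRes n D p₁ Q v') := by
  rw [kick_dechirp_qft_phi8bKet, qftInv_qft, smul_smul]
  congr 1
  exact mul_comm _ _

/-! ### 3. Born law of the circuit: the offset with certainty -/

/-- Born weights after the circuit: `|G_P|² · N^{2(n+1)}` on `u = v′ mod N`, zero elsewhere.
[cite: ChenQuantumLattice2024, §3.5.9 p. 35] -/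
theorem weight_dechirpCircuit (u : Fin (n + 1) → ZN D p₁ Q) :
    weight (qftInv (kick (dechirpKick n D p₁ Q b) (qft (phi8bKet n D p₁ Q b v')))) u
      = if u = offsetRes n D p₁ Q v' then
          ‖chirpGauss p₁ Q‖ ^ 2 * ((((D * D * (p₁ * Q) : ℕ+) : ℕ) : ℝ) ^ (n + 1)) ^ 2
        else 0 := by
  classical
  rw [qftInv_kick_dechirp_qft_phi8bKet, weight, Pi.smul_apply, smul_eq_mul]
  unfold basisKet
  split_ifs with h
  · rw [mul_one, norm_mul, norm_pow, Complex.norm_natCast, mul_pow]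
  · rw [mul_zero, norm_zero, zero_pow two_ne_zero]

/-- Every outcome other than `v′ mod N` has Born weight `0`. [cite: ChenQuantumLattice2024, §3.5.9 p. 35] -/
theorem weight_dechirpCircuit_of_ne {u : Fin (n + 1) → ZN D p₁ Q} (hu : u ≠ offsetRes n D p₁ Q v') :
    weight (qftInv (kick (dechirpKick n D p₁ Q b) (qft (phi8bKet n D p₁ Q b v')))) u = 0 := by
  rw [weight_dechirpCircuit, if_neg hu]

/-- All the Born weight sits on `v′ mod N`: `Σ_u weight u = weight (v′ mod N)` (outcome `v′ mod N` with
probability one). [cite: ChenQuantumLattice2024, §3.5.9 p. 35] -/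
theorem sum_weight_dechirpCircuit :
    ∑ u, weight (qftInv (kick (dechirpKick n D p₁ Q b) (qft (phi8bKet n D p₁ Q b v')))) u
      = weight (qftInv (kick (dechirpKick n D p₁ Q b) (qft (phi8bKet n D p₁ Q b v'))))
          (offsetRes n D p₁ Q v') := by
  classical
  simp only [weight_dechirpCircuit, Finset.sum_ite_eq', Finset.mem_univ, if_true]

/-- For odd `P` that weight is `P · N^{2(n+1)} > 0` (the circuit output is not the zero vector: the
certainty statement is not vacuous). [cite: ChenQuantumLattice2024, §3.5.9 p. 35; Korobov1992, Ch. I §3 Thm 3] -/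
theorem weight_dechirpCircuit_offsetRes (hP : Odd ((p₁ * Q : ℕ+) : ℕ)) :
    weight (qftInv (kick (dechirpKick n D p₁ Q b) (qft (phi8bKet n D p₁ Q b v'))))
        (offsetRes n D p₁ Q v')
      = ((p₁ * Q : ℕ+) : ℕ) * ((((D * D * (p₁ * Q) : ℕ+) : ℕ) : ℝ) ^ (n + 1)) ^ 2
    ∧ 0 < weight (qftInv (kick (dechirpKick n D p₁ Q b) (qft (phi8bKet n D p₁ Q b v'))))
        (offsetRes n D p₁ Q v') := by
  rw [weight_dechirpCircuit, if_pos rfl, norm_sq_chirpGauss p₁ Q hP]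
  refine ⟨rfl, ?_⟩
  have hN : (0 : ℝ) < ((((D * D * (p₁ * Q) : ℕ+) : ℕ) : ℝ)) := by exact_mod_cast PNat.pos _
  have hPpos : (0 : ℝ) < (((p₁ * Q : ℕ+) : ℕ) : ℝ) := by exact_mod_cast PNat.pos _
  positivity

/-! ### 4. A wrong direction leaves a residual chirp -/

/-- De-chirping `QFT|φ_{b,v′}⟩` with the kick of ANOTHER direction `b′` leaves
`G_P · ψ_P(⟨b,u⟩² − ⟨b′,u⟩²) · ψ_N(−⟨v′,u⟩)` — the residual quadratic phase `⟨b,y⟩² − ⟨b′,y⟩² (mod P)`.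
[cite: ChenQuantumLattice2024, §3.5.9 p. 35] -/
theorem kick_dechirp_qft_phi8bKet_dir (b' : Fin (n + 1) → ℤ) (u : Fin (n + 1) → ZN D p₁ Q) :
    kick (dechirpKick n D p₁ Q b') (qft (phi8bKet n D p₁ Q b v')) u
      = chirpGauss p₁ Q * ZMod.stdAddChar (lineFun n D p₁ Q b u ^ 2 - lineFun n D p₁ Q b' u ^ 2)
          * ZMod.stdAddChar (-offsetFun n D p₁ Q v' u) := by
  show qft (phi8bKet n D p₁ Q b v') u * e (dechirpKick n D p₁ Q b' u) = _
  rw [qft_phi8bKet_eq_chirpGauss_mul, e_dechirpKick, sub_eq_add_neg, AddChar.map_add_eq_mul]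
  ring

end Dechirp

end Literature.Computability.Cryptography.Chen2024
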